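import Summits.QuantumFields.BalabanUV.T4Continuum.Support.VariationalVectorFederbushLinePhys
import Summits.QuantumFields.BalabanUV.T4Continuum.Support.VariationalTaxiCoarse

/-!
# T⁴ programme, spine node NE2 (U1a), lane P2 — SUPPLIER ITEM «V-COL-TAXI»: OPERATOR (NON-ABELIAN) TAXI TRANSPORTS built from contractive bond
# operators — the in-block step defect and FED⁺'s one-block site mismatch FROM THE OPERATOR PLAQUETTE DEFECT ALONE; V-FED's curl half at taxi data

NE2 formalisation swarm `b2b-balaban-t4-ne2-formalise-*`, leaf prover 04 GEN 4 (`prover-b2b-balaban-t4-ne2-formalise-leaf-04-g4-0`); register row «P2-sup»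
of `t4/formal/NE2/LEAVES.md`; journal CLAIMS.log «V-COL-TAXI».  The operator twin of this lineage's U(1) dictionary `VariationalTaxiTransport` (gen 2),
named «NOT CLAIMED … ordered products — a separate geometric leaf» in `VariationalColourUpperBound` ∕ `VectorBlockTrialFormCovariant` and «WHAT IS NOT
HERE: the size of `m₀`» in `VariationalVectorFederbushLinePhys` (V-FED file 5).  The P2 leaves for `E`-valued 0-forms and 1-forms treat the SITE
transports `T′(x) : E →L[ℂ] E` (fibre at the fine site `x` ↦ fibre at its block) and the COARSE bond transports `Rc(y,μ)` as DATA; for V-FED with product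
line transports `lineT T′ R′` exactly ONE transport binder is left, FED⁺'s site mismatch `‖misv Rc R′ T′ (y,μ,j)‖ ≤ m₀`,
`misv = Rc(y,μ) ∘ T′(L·(y+e_μ)+j) − T′(L·y+j) ∘ Π^μ_L(L·y+j)`.  For Bałaban-type data `T′` is the transport of the fine bond field along a contour from
the block base point and `Rc` the transport along the straight line joining base points ([Balaban1985BackgroundPropagators] (3.10), (3.15), (3.19)
pp.392–393 — SHAPES only; here taxi contours, bond operators DATA on any normed ℂ-space, ORDERED products, no commutativity, no inverses).  This file
DEFINES those transports and proves the binders from the operator plaquette defect `‖R′(x,κ)∘R′(x+e_κ,ι) − R′(x,ι)∘R′(x+e_ι,κ)‖ ≤ a` alone, by the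
rectangle estimates of `VariationalVectorFederbushLine` (`norm_mul_piTv_sub_le`: one bond across `ℓ` bonds costs `ℓ·a`; `norm_piTv_comm_sub_le`: an
`m × ℓ` rectangle costs `m·ℓ·a`) BY NAME.
OBJECTS ([folklore]; `R′(x,μ)` : fibre at `x+e_μ` → fibre at `x` as in `VariationalColourFederbush.cDv`∕`piTv`; corners `corner L N y j i`, `corner_zero`, `corner_next` = gen 2's `VariationalTaxiTransport` ∕ `…TaxiCoarse` BY NAME):
`legTv R′ y j i := Π^i_{j_i}(corner y j i)`, `taxiAcc R′ y j i := legTv 0 ∘ ⋯ ∘ legTv (i−1)` (recursive ORDERED product, the leg at the base point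
leftmost), **`taxiTv R′ x := taxiAcc R′ (blockOf x) (digits x) d`** (fibre at `x` → fibre at the base point `L·blockOf x`), **`coarseTv R′ y μ := Π^μ_L(L·y)`**.
THEOREMS.  §2 `piTv_add`, contraction ∕ unitarity of legs, taxis, coarsenings, `taxiTv_bpt`, `taxiTv_base`; §3 THE `μ`-STEP (operator form of gen 2's
`taxi_succ`, the holonomy as an ESTIMATE: the new `μ`-bond crosses each later leg `k > μ` through `j_k ≤ L−1` plaquettes) ⟹ **`inBlock_defect_taxiTv_le`**:
`j_μ + 1 < L → ‖taxiTv R′ (L·y+j+e_μ) − taxiTv R′ (L·y+j) ∘ R′(L·y+j, μ)‖ ≤ (d−1)(L−1)·a`; §4 THE SITE MISMATCH by induction over the legs (a leg `k ≠ μ` is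
crossed by the `L`-run through an `L × j_k` rectangle, the leg `k = μ` commutes EXACTLY by `piTv_add`) ⟹ **`norm_misv_taxi_le`**:
`‖misv L N (coarseTv R′) R′ (taxiTv R′) y μ j‖ ≤ (d−1)·L·(L−1)·a` — V-FED's `m₀` and FED⁺-colour's `m` at taxi data; §5 **`ScV_QvL_taxi_le_curl`** =
`VariationalVectorFederbushLinePhys.ScV_QvL_line_le_curl` AT TAXI DATA with `hT′`∕`hmis` DISCHARGED — binders `‖R′‖ ≤ 1`, `0 ≤ a`, the plaquette defect,
`0 ≤ G′`; honest size under the scale-invariant class `(nL)²·a ≤ c`: `δ_curl ≤ 2d(L+d)·c∕n`, geometric along the tower.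
WHAT IS NOT HERE (stated, not hidden): the `G`-half of `hFED` (leaf V-GF); the in-block binders of UB⁺-colour ∕ ONE⁺-colour ∕ V-UB-L in their own
letters (they follow from §3 for unitary data — a sequel); the operator NESTED taxi tower (gen 3's `nestT` pattern); frames; the END (road owner).

HONEST FRAMING (T4-DAG p. 1).  A model-level DICTIONARY between two hypothesis sets of OUR leaves (site-transport mismatch as data ↦ bond operators and
their plaquette defect as data); [folklore] ordered-product bookkeeping; nothing printed is a hypothesis (the one `[cite:]` tag is a SHAPE locator); no
B0 (trigger c5): no identification of `R′` with Bałaban's `U(Γ)`; data `def`s `legTv` ∕ `taxiAcc` ∕ `taxiTv` ∕ `coarseTv` only, no `def … : Prop`, no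
`sorry`; axioms standard.  NE2 NOT proved on either road; NE3 OPEN; spine PROVED 0∕9 unchanged; rung (B)+1 finite T⁴ — NOT infinite volume, NOT mass gap,
NOT Clay.  HONEST DEPENDENCY (cell, verbatim): continuum YM on T⁴ ⇐ BetaPertH ∧ nine spine estimates (0/9 proved); BetaPertH ⇐ (D1) ∧ (D4) ∧ CAP+tail;
G-an2-4 gates asym, D1 and NE2/3/4.
-/

noncomputable section

namespace Summit.QuantumFields.BalabanUV.T4Continuum.VariationalColourTaxiTransport

open Literature.MathematicalPhysics.QuantumFieldTheory.Balaban1983to89.B5Prop11Plancherel (Tor fine unitVec)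
open Literature.MathematicalPhysics.QuantumFieldTheory.Balaban1983to89.B5Block118 (tstep tstep_zero tstep_succ bpt bpt_add_tstep)
open Literature.MathematicalPhysics.QuantumFieldTheory.Balaban1983to89.B5Blocks16 (blockOf blockOf_bpt)
open Summit.QuantumFields.BalabanUV.T4Continuum.ScalarBlockTrialFunction (digits digits_bpt bpt_add_unitVec_of_lt)
open Summit.QuantumFields.BalabanUV.T4Continuum.VariationalTaxiTransport (below corner corner_succ corner_d corner_update)
open Summit.QuantumFields.BalabanUV.T4Continuum.VariationalTaxiCoarse (corner_zero corner_next)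
open Summit.QuantumFields.BalabanUV.T4Continuum.VariationalColourFederbush (piTv misv norm_piTv_le_one)
open Summit.QuantumFields.BalabanUV.T4Continuum.VariationalVectorFederbush
  (lineT norm_mul_piTv_sub_le norm_piTv_comm_sub_le ScV_QvL_line_le_curl)
open Summit.QuantumFields.BalabanUV.T4Continuum.VectorBlockTrialForm (QvL)
open Summit.QuantumFields.BalabanUV.T4Continuum.VariationalVectorForm (ScV SfV qVV)

variable {d : ℕ} {E : Type*} [NormedAddCommGroup E] [NormedSpace ℂ E]

/-! ## §1 The operator taxi transports and the straight coarsening -/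

section Defs

variable (L : ℕ) [NeZero L] (N : Fin d → ℕ) [hN : ∀ μ, NeZero (N μ)]

/-- the `i`-th LEG of the taxi transport: the straight transporter of `j_i` bonds in direction `i` from the `i`-th corner (`1` beyond `d`); fibre at
`corner (i+1)` ↦ fibre at `corner i`. [folklore] -/
def legTv (R' : Tor (fine L N) → Fin d → (E →L[ℂ] E)) (y : Tor N) (j : Fin d → Fin L) (i : ℕ) : E →L[ℂ] E :=
  if h : i < d then piTv L N R' (corner L N y j i) ⟨i, h⟩ (j ⟨i, h⟩ : ℕ) else 1

/-- the ORDERED product of the first `i` legs, the leg at the base point leftmost: fibre at `corner i` ↦ fibre at the base point. [folklore] -/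
def taxiAcc (R' : Tor (fine L N) → Fin d → (E →L[ℂ] E)) (y : Tor N) (j : Fin d → Fin L) : ℕ → (E →L[ℂ] E)
  | 0 => 1
  | i + 1 => taxiAcc R' y j i * legTv L N R' y j i

/-- **THE OPERATOR TAXI SITE TRANSPORT** `taxiTv R′ x` : fibre at the fine site `x` ↦ fibre at the base point of its block, along the taxi contour (legs
in increasing coordinate order). [cite: Balaban1985BackgroundPropagators, (3.19) p.393 (shape «R(U(Γ_{y,x}))»; here taxi contours, operators data)] [folklore] -/
def taxiTv (R' : Tor (fine L N) → Fin d → (E →L[ℂ] E)) (x : Tor (fine L N)) : E →L[ℂ] E :=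
  taxiAcc L N R' (blockOf L N x) (digits L N x) d

/-- **THE STRAIGHT COARSENING** `coarseTv R′ y μ = Π^μ_L(L·y)` : fibre at the base point of block `y + e_μ` ↦ fibre at the base point of block `y`
(the `L` fine bonds joining them). [folklore] -/
def coarseTv (R' : Tor (fine L N) → Fin d → (E →L[ℂ] E)) (y : Tor N) (μ : Fin d) : E →L[ℂ] E :=
  piTv L N R' (bpt L N y 0) μ L

end Defs

/-! ## §2 Elementary properties: splitting straight transporters, contraction, unitarity, base points -/

section Basic

variable (L : ℕ) [NeZero L] (N : Fin d → ℕ) [hN : ∀ μ, NeZero (N μ)]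

omit [NeZero L] hN in
/-- **splitting a straight transporter**: `Π_{s+t}(x) = Π_s(x) ∘ Π_t(x + s e_μ)`. [folklore] -/
theorem piTv_add (R' : Tor (fine L N) → Fin d → (E →L[ℂ] E)) (x : Tor (fine L N)) (μ : Fin d) (s t : ℕ) :
    piTv L N R' x μ (s + t) = piTv L N R' x μ s * piTv L N R' (x + tstep (fine L N) μ s) μ t := by
  induction t with
  | zero => simp [piTv]
  | succ t ih =>
    rw [← add_assoc]
    simp only [piTv, ih, mul_assoc, VectorBlockTrialForm.tstep_add L N μ s t, add_assoc]

variable {R' : Tor (fine L N) → Fin d → (E →L[ℂ] E)}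

/-- `taxiTv` at a block point. [folklore] -/
theorem taxiTv_bpt (y : Tor N) (j : Fin d → Fin L) : taxiTv L N R' (bpt L N y j) = taxiAcc L N R' y j d := by
  rw [taxiTv, blockOf_bpt, digits_bpt]

/-- at a base point the taxi transport is the identity (every leg has length `0`). [folklore] -/
theorem taxiTv_base (y : Tor N) : taxiTv L N R' (bpt L N y 0) = 1 := by
  rw [taxiTv_bpt]
  suffices h : ∀ i, taxiAcc L N R' y 0 i = 1 from h d
  intro i
  induction i with
  | zero => rfl
  | succ i ih => simp only [taxiAcc, ih, one_mul]; unfold legTv; split_ifs <;> simp [piTv]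

variable (hR' : ∀ x μ, ‖R' x μ‖ ≤ 1)
include hR'

omit hN in
/-- contractive bonds give contractive legs. [folklore] -/
theorem norm_legTv_le_one (y : Tor N) (j : Fin d → Fin L) (i : ℕ) : ‖legTv L N R' y j i‖ ≤ 1 := by
  unfold legTv
  split_ifs with h
  · exact norm_piTv_le_one L N hR' _ _ _
  · exact ContinuousLinearMap.norm_id_le

omit hN in
/-- contractive bonds give contractive accumulated transports. [folklore] -/
theorem norm_taxiAcc_le_one (y : Tor N) (j : Fin d → Fin L) (i : ℕ) : ‖taxiAcc L N R' y j i‖ ≤ 1 := by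
  induction i with
  | zero => exact ContinuousLinearMap.norm_id_le
  | succ i ih => exact (norm_mul_le _ _).trans (by nlinarith [norm_legTv_le_one L N hR' y j i, norm_nonneg (legTv L N R' y j i)])

/-- **contractive bonds give contractive taxi transports** — the `‖T′‖ ≤ 1` binder of the leaves at taxi data. [folklore] -/
theorem norm_taxiTv_le_one (x : Tor (fine L N)) : ‖taxiTv L N R' x‖ ≤ 1 := norm_taxiAcc_le_one L N hR' _ _ _

omit hN in
/-- contractive bonds give contractive coarsenings — the `‖Rc‖ ≤ 1` binder at taxi data. [folklore] -/
theorem norm_coarseTv_le_one (y : Tor N) (μ : Fin d) : ‖coarseTv L N R' y μ‖ ≤ 1 := norm_piTv_le_one L N hR' _ _ _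

end Basic

section Unitary

variable (L : ℕ) [NeZero L] (N : Fin d → ℕ) [hN : ∀ μ, NeZero (N μ)]
variable {H : Type*} [NormedAddCommGroup H] [InnerProductSpace ℂ H] [CompleteSpace H]
variable {R' : Tor (fine L N) → Fin d → (H →L[ℂ] H)} (hU : ∀ x μ, R' x μ ∈ unitary (H →L[ℂ] H))
include hU

omit [NeZero L] hN in
/-- unitary bonds give unitary straight transporters. [folklore] -/
theorem piTv_mem_unitary (x : Tor (fine L N)) (μ : Fin d) (t : ℕ) : piTv L N R' x μ t ∈ unitary (H →L[ℂ] H) := by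
  induction t with
  | zero => exact Submonoid.one_mem _
  | succ t ih => exact mul_mem ih (hU _ _)

omit hN in
/-- unitary bonds give unitary legs. [folklore] -/
theorem legTv_mem_unitary (y : Tor N) (j : Fin d → Fin L) (i : ℕ) : legTv L N R' y j i ∈ unitary (H →L[ℂ] H) := by
  unfold legTv
  split_ifs with h
  · exact piTv_mem_unitary L N hU _ _ _
  · exact Submonoid.one_mem _

omit hN in
/-- unitary bonds give unitary accumulated transports. [folklore] -/
theorem taxiAcc_mem_unitary (y : Tor N) (j : Fin d → Fin L) (i : ℕ) : taxiAcc L N R' y j i ∈ unitary (H →L[ℂ] H) := by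
  induction i with
  | zero => exact Submonoid.one_mem _
  | succ i ih => exact mul_mem ih (legTv_mem_unitary L N hU y j i)

/-- **unitary bonds give unitary taxi transports** (so right inverses of norm `≤ 1` exist: the adjoints). [folklore] -/
theorem taxiTv_mem_unitary (x : Tor (fine L N)) : taxiTv L N R' x ∈ unitary (H →L[ℂ] H) := taxiAcc_mem_unitary L N hU _ _ _

omit hN in
/-- unitary bonds give unitary coarsenings. [folklore] -/
theorem coarseTv_mem_unitary (y : Tor N) (μ : Fin d) : coarseTv L N R' y μ ∈ unitary (H →L[ℂ] H) := piTv_mem_unitary L N hU _ _ _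

end Unitary

/-! ## §3 The `μ`-step: the in-block transport defect of operator taxi transports -/

section Step

variable (L : ℕ) [NeZero L] (N : Fin d → ℕ) [hN : ∀ μ, NeZero (N μ)]
variable {R' : Tor (fine L N) → Fin d → (E →L[ℂ] E)} (hR' : ∀ x μ, ‖R' x μ‖ ≤ 1) {a : ℝ}
  (ha : ∀ x κ ι, ‖R' x κ * R' (x + unitVec (fine L N) κ) ι - R' x ι * R' (x + unitVec (fine L N) ι) κ‖ ≤ a)

omit hN in
/-- the `μ`-step leaves the legs below `μ` alone. [folklore] -/
theorem legTv_update_of_lt (y : Tor N) (j : Fin d → Fin L) (μ : Fin d) (h : (j μ : ℕ) + 1 < L) {i : ℕ} (hi : i < (μ : ℕ)) :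
    legTv L N R' y (Function.update j μ ⟨(j μ : ℕ) + 1, h⟩) i = legTv L N R' y j i := by
  have hid : i < d := hi.trans μ.is_lt
  have hne : (⟨i, hid⟩ : Fin d) ≠ μ := fun e => by have := congrArg Fin.val e; simp at this; omega
  simp only [legTv, dif_pos hid, corner_update L N y j μ h i, if_neg (not_lt.mpr hi.le), Function.update_of_ne hne]

omit hN in
/-- the `μ`-step extends the `μ`-th leg by the new bond. [folklore] -/
theorem legTv_update_self (y : Tor N) (j : Fin d → Fin L) (μ : Fin d) (h : (j μ : ℕ) + 1 < L) :
    legTv L N R' y (Function.update j μ ⟨(j μ : ℕ) + 1, h⟩) μ = legTv L N R' y j μ * R' (corner L N y j ((μ : ℕ) + 1)) μ := by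
  have hμd : (μ : ℕ) < d := μ.is_lt
  have hc : corner L N y (Function.update j μ ⟨(j μ : ℕ) + 1, h⟩) μ = corner L N y j μ := by
    rw [corner_update L N y j μ h μ, if_neg (lt_irrefl _)]
  have hjμ : ((Function.update j μ ⟨(j μ : ℕ) + 1, h⟩) μ : ℕ) = (j μ : ℕ) + 1 := by simp
  simp only [legTv, dif_pos hμd, Fin.eta, hc, hjμ, corner_succ L N y j hμd, piTv]

omit hN in
/-- the `μ`-step shifts the legs above `μ` by `e_μ`. [folklore] -/
theorem legTv_update_of_gt (y : Tor N) (j : Fin d → Fin L) (μ : Fin d) (h : (j μ : ℕ) + 1 < L) {i : ℕ} (hμi : (μ : ℕ) < i)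
    (hid : i < d) :
    legTv L N R' y (Function.update j μ ⟨(j μ : ℕ) + 1, h⟩) i
      = piTv L N R' (corner L N y j i + unitVec (fine L N) μ) ⟨i, hid⟩ (j ⟨i, hid⟩ : ℕ) := by
  have hne : (⟨i, hid⟩ : Fin d) ≠ μ := fun e => by have := congrArg Fin.val e; simp at this; omega
  simp only [legTv, dif_pos hid, corner_update L N y j μ h i, if_pos hμi, Function.update_of_ne hne]

omit hN in
/-- below `μ` the accumulated transports agree. [folklore] -/
theorem taxiAcc_update_of_le (y : Tor N) (j : Fin d → Fin L) (μ : Fin d) (h : (j μ : ℕ) + 1 < L) {i : ℕ} (hi : i ≤ (μ : ℕ)) :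
    taxiAcc L N R' y (Function.update j μ ⟨(j μ : ℕ) + 1, h⟩) i = taxiAcc L N R' y j i := by
  induction i with
  | zero => rfl
  | succ i ih =>
    simp only [taxiAcc, ih (Nat.le_of_succ_le hi), legTv_update_of_lt L N y j μ h (Nat.lt_of_succ_le hi)]

include hR' ha

omit hN in
/-- **THE `μ`-STEP, ACCUMULATED**: after the legs `μ+1, …, k−1` have been crossed by the new bond,
`‖taxiAcc R′ y (j + δ_μ) k − taxiAcc R′ y j k ∘ R′(corner y j k, μ)‖ ≤ (k − (μ+1))·(L−1)·a` (`μ + 1 ≤ k ≤ d`). [folklore] -/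
theorem taxiAcc_update_sub_le (y : Tor N) (j : Fin d → Fin L) (μ : Fin d) (h : (j μ : ℕ) + 1 < L) {k : ℕ} (hμk : (μ : ℕ) + 1 ≤ k)
    (hkd : k ≤ d) :
    ‖taxiAcc L N R' y (Function.update j μ ⟨(j μ : ℕ) + 1, h⟩) k - taxiAcc L N R' y j k * R' (corner L N y j k) μ‖
      ≤ ((k - ((μ : ℕ) + 1) : ℕ) : ℝ) * ((L - 1 : ℕ) : ℝ) * a := by
  have ha0 : 0 ≤ a := (norm_nonneg _).trans (ha (corner L N y j 0) μ μ)
  induction k, hμk using Nat.le_induction with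
  | base =>
    -- `taxiAcc' (μ+1) = taxiAcc μ ∘ (leg μ ∘ R′(corner (μ+1), μ))` exactly
    have e : taxiAcc L N R' y (Function.update j μ ⟨(j μ : ℕ) + 1, h⟩) ((μ : ℕ) + 1)
        = taxiAcc L N R' y j ((μ : ℕ) + 1) * R' (corner L N y j ((μ : ℕ) + 1)) μ := by
      simp only [taxiAcc, taxiAcc_update_of_le L N y j μ h le_rfl, legTv_update_self L N y j μ h, mul_assoc]
    rw [e, sub_self, norm_zero, Nat.sub_self, Nat.cast_zero, zero_mul, zero_mul]
  | succ k hμk ih =>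
    have hkd' : k < d := Nat.lt_of_succ_le hkd
    have ih' := ih hkd'.le
    have hleg' := legTv_update_of_gt L N (R' := R') y j μ h (Nat.lt_of_succ_le hμk) hkd'
    set j' := Function.update j μ ⟨(j μ : ℕ) + 1, h⟩ with hj'
    have hleg : legTv L N R' y j k = piTv L N R' (corner L N y j k) ⟨k, hkd'⟩ (j ⟨k, hkd'⟩ : ℕ) := by simp [legTv, dif_pos hkd']
    have hone := norm_mul_piTv_sub_le L N hR' ha (corner L N y j k) μ ⟨k, hkd'⟩ (j ⟨k, hkd'⟩ : ℕ)
    rw [← corner_succ L N y j hkd'] at hone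
    -- insert `taxiAcc k ∘ R′(corner k, μ) ∘ leg′ k`
    have e : taxiAcc L N R' y j' (k + 1) - taxiAcc L N R' y j (k + 1) * R' (corner L N y j (k + 1)) μ
        = (taxiAcc L N R' y j' k - taxiAcc L N R' y j k * R' (corner L N y j k) μ) * legTv L N R' y j' k
          + taxiAcc L N R' y j k * (R' (corner L N y j k) μ * piTv L N R' (corner L N y j k + unitVec (fine L N) μ) ⟨k, hkd'⟩ (j ⟨k, hkd'⟩ : ℕ)
              - piTv L N R' (corner L N y j k) ⟨k, hkd'⟩ (j ⟨k, hkd'⟩ : ℕ) * R' (corner L N y j (k + 1)) μ) := by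
      simp only [taxiAcc, hleg', hleg, sub_mul, mul_sub, mul_assoc]; abel
    rw [e]
    have hjk : ((j ⟨k, hkd'⟩ : ℕ) : ℝ) ≤ ((L - 1 : ℕ) : ℝ) := by exact_mod_cast Nat.le_sub_one_of_lt (j ⟨k, hkd'⟩).is_lt
    have hcnt : ((k + 1 - ((μ : ℕ) + 1) : ℕ) : ℝ) = ((k - ((μ : ℕ) + 1) : ℕ) : ℝ) + 1 := by
      rw [show k + 1 - ((μ : ℕ) + 1) = (k - ((μ : ℕ) + 1)) + 1 by omega]; push_cast; ring
    calc _ ≤ ‖(taxiAcc L N R' y j' k - taxiAcc L N R' y j k * R' (corner L N y j k) μ) * legTv L N R' y j' k‖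
          + ‖taxiAcc L N R' y j k * (R' (corner L N y j k) μ * piTv L N R' (corner L N y j k + unitVec (fine L N) μ) ⟨k, hkd'⟩ (j ⟨k, hkd'⟩ : ℕ)
              - piTv L N R' (corner L N y j k) ⟨k, hkd'⟩ (j ⟨k, hkd'⟩ : ℕ) * R' (corner L N y j (k + 1)) μ)‖ := norm_add_le _ _
      _ ≤ ((k - ((μ : ℕ) + 1) : ℕ) : ℝ) * ((L - 1 : ℕ) : ℝ) * a * 1 + 1 * (((L - 1 : ℕ) : ℝ) * a) := by
          refine add_le_add ((norm_mul_le _ _).trans (mul_le_mul ih' (norm_legTv_le_one L N hR' y j' k) (norm_nonneg _) (by positivity)))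
            ((norm_mul_le _ _).trans (mul_le_mul (norm_taxiAcc_le_one L N hR' y j k) (hone.trans ?_) (norm_nonneg _) zero_le_one))
          exact mul_le_mul_of_nonneg_right hjk ha0
      _ = ((k + 1 - ((μ : ℕ) + 1) : ℕ) : ℝ) * ((L - 1 : ℕ) : ℝ) * a := by rw [hcnt]; ring

/-- **THE IN-BLOCK TRANSPORT DEFECT OF OPERATOR TAXI TRANSPORTS**, derived from the operator plaquette defect alone:
`j_μ + 1 < L → ‖taxiTv R′ (L·y + j + e_μ) − taxiTv R′ (L·y + j) ∘ R′(L·y + j, μ)‖ ≤ (d−1)·(L−1)·a` — the inverse-free form of the `hw`∕`hin`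
binders of UB⁺-colour ∕ ONE⁺-colour ∕ V-UB (for unitary data conjugate by the adjoints). [folklore] -/
theorem inBlock_defect_taxiTv_le (y : Tor N) (j : Fin d → Fin L) (μ : Fin d) (h : (j μ : ℕ) + 1 < L) :
    ‖taxiTv L N R' (bpt L N y j + unitVec (fine L N) μ) - taxiTv L N R' (bpt L N y j) * R' (bpt L N y j) μ‖
      ≤ ((d - 1 : ℕ) : ℝ) * ((L - 1 : ℕ) : ℝ) * a := by
  have ha0 : 0 ≤ a := (norm_nonneg _).trans (ha (corner L N y j 0) μ μ)
  have h1 := taxiAcc_update_sub_le L N hR' ha y j μ h (Nat.succ_le_of_lt μ.is_lt) le_rfl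
  rw [corner_d] at h1
  rw [bpt_add_unitVec_of_lt L N y j μ h, taxiTv_bpt, taxiTv_bpt]
  refine h1.trans (mul_le_mul_of_nonneg_right (mul_le_mul_of_nonneg_right ?_ (Nat.cast_nonneg _)) ha0)
  exact_mod_cast Nat.sub_le_sub_left (Nat.le_add_left 1 (μ : ℕ)) d

end Step

/-! ## §4 FED⁺'s one-block site mismatch of taxi data -/

section Mismatch

variable (L : ℕ) [NeZero L] (N : Fin d → ℕ) [hN : ∀ μ, NeZero (N μ)]
variable {R' : Tor (fine L N) → Fin d → (E →L[ℂ] E)} (hR' : ∀ x μ, ‖R' x μ‖ ≤ 1) {a : ℝ}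
  (ha : ∀ x κ ι, ‖R' x κ * R' (x + unitVec (fine L N) κ) ι - R' x ι * R' (x + unitVec (fine L N) ι) κ‖ ≤ a)
include hR' ha

omit hN in
/-- **THE `L`-RUN ACROSS THE FIRST `k` LEGS**: `‖Π^μ_L(L·y) ∘ taxiAcc R′ (y+e_μ) j k − taxiAcc R′ y j k ∘ Π^μ_L(corner y j k)‖ ≤ #{i < k, i ≠ μ}·L·(L−1)·a`
— each leg `i ≠ μ` is an `L × j_i` rectangle, the leg `i = μ` lies on the run's own line and commutes exactly. [folklore] -/
theorem coarse_mul_taxiAcc_sub_le (y : Tor N) (j : Fin d → Fin L) (μ : Fin d) {k : ℕ} (hkd : k ≤ d) :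
    ‖piTv L N R' (bpt L N y 0) μ L * taxiAcc L N R' (y + unitVec N μ) j k - taxiAcc L N R' y j k * piTv L N R' (corner L N y j k) μ L‖
      ≤ ((k - (if (μ : ℕ) < k then 1 else 0) : ℕ) : ℝ) * ((L : ℝ) * ((L - 1 : ℕ) : ℝ) * a) := by
  have ha0 : 0 ≤ a := (norm_nonneg _).trans (ha (corner L N y j 0) μ μ)
  induction k with
  | zero => simp [taxiAcc, corner_zero]
  | succ k ih =>
    have hkd' : k < d := Nat.lt_of_succ_le hkd
    have ih' := ih hkd'.le
    set c := corner L N y j k with hc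
    have hleg : legTv L N R' y j k = piTv L N R' c ⟨k, hkd'⟩ (j ⟨k, hkd'⟩ : ℕ) := by simp [legTv, dif_pos hkd', hc]
    have hleg' : legTv L N R' (y + unitVec N μ) j k = piTv L N R' (c + tstep (fine L N) μ L) ⟨k, hkd'⟩ (j ⟨k, hkd'⟩ : ℕ) := by
      simp [legTv, dif_pos hkd', hc, corner_next]
    have hsucc : corner L N y j (k + 1) = c + tstep (fine L N) ⟨k, hkd'⟩ (j ⟨k, hkd'⟩ : ℕ) := corner_succ L N y j hkd'
    -- the leg term: a rectangle if `k ≠ μ`, exact commutation if `k = μ`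
    have hlegterm : ‖piTv L N R' c μ L * piTv L N R' (c + tstep (fine L N) μ L) ⟨k, hkd'⟩ (j ⟨k, hkd'⟩ : ℕ)
          - piTv L N R' c ⟨k, hkd'⟩ (j ⟨k, hkd'⟩ : ℕ) * piTv L N R' (c + tstep (fine L N) ⟨k, hkd'⟩ (j ⟨k, hkd'⟩ : ℕ)) μ L‖
        ≤ (if (⟨k, hkd'⟩ : Fin d) = μ then 0 else 1) * ((L : ℝ) * ((L - 1 : ℕ) : ℝ) * a) := by
      split_ifs with hkμ
      · rw [hkμ, ← piTv_add, ← piTv_add, add_comm, sub_self, norm_zero, zero_mul]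
      · rw [one_mul]
        refine (norm_piTv_comm_sub_le L N hR' ha c μ ⟨k, hkd'⟩ L (j ⟨k, hkd'⟩ : ℕ)).trans ?_
        have hjk : ((j ⟨k, hkd'⟩ : ℕ) : ℝ) ≤ ((L - 1 : ℕ) : ℝ) := by exact_mod_cast Nat.le_sub_one_of_lt (j ⟨k, hkd'⟩).is_lt
        have hL0 : (0 : ℝ) ≤ L := Nat.cast_nonneg _
        nlinarith [mul_nonneg hL0 ha0]
    -- the count bookkeeping
    have hcnt : ((k + 1 - (if (μ : ℕ) < k + 1 then 1 else 0) : ℕ) : ℝ)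
        = ((k - (if (μ : ℕ) < k then 1 else 0) : ℕ) : ℝ) + (if (⟨k, hkd'⟩ : Fin d) = μ then 0 else 1) := by
      by_cases hkμ : (⟨k, hkd'⟩ : Fin d) = μ
      · have hk : k = (μ : ℕ) := by rw [← hkμ]
        rw [if_pos hkμ, hk]; simp
      · have hk : k ≠ (μ : ℕ) := fun e => hkμ (Fin.ext e)
        rw [if_neg hkμ]
        by_cases hlt : (μ : ℕ) < k
        · rw [if_pos hlt, if_pos (Nat.lt_succ_of_lt hlt), show k + 1 - 1 = (k - 1) + 1 by omega]; push_cast; ring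
        · have hgt : k < (μ : ℕ) := lt_of_le_of_ne (not_lt.mp hlt) hk
          rw [if_neg hlt, if_neg (by omega), Nat.sub_zero, Nat.sub_zero]; push_cast; ring
    -- insert `taxiAcc k ∘ Π^μ_L(c) ∘ leg′ k`
    have e : piTv L N R' (bpt L N y 0) μ L * taxiAcc L N R' (y + unitVec N μ) j (k + 1)
          - taxiAcc L N R' y j (k + 1) * piTv L N R' (corner L N y j (k + 1)) μ L
        = (piTv L N R' (bpt L N y 0) μ L * taxiAcc L N R' (y + unitVec N μ) j k - taxiAcc L N R' y j k * piTv L N R' c μ L)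
            * legTv L N R' (y + unitVec N μ) j k
          + taxiAcc L N R' y j k * (piTv L N R' c μ L * piTv L N R' (c + tstep (fine L N) μ L) ⟨k, hkd'⟩ (j ⟨k, hkd'⟩ : ℕ)
              - piTv L N R' c ⟨k, hkd'⟩ (j ⟨k, hkd'⟩ : ℕ) * piTv L N R' (c + tstep (fine L N) ⟨k, hkd'⟩ (j ⟨k, hkd'⟩ : ℕ)) μ L) := by
      rw [hsucc]
      simp only [taxiAcc, hleg', hleg, sub_mul, mul_sub, mul_assoc]; abel
    rw [e, hcnt, add_mul]
    refine (norm_add_le _ _).trans (add_le_add ((norm_mul_le _ _).trans ?_) ((norm_mul_le _ _).trans ?_))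
    · exact (mul_le_mul ih' (norm_legTv_le_one L N hR' _ j k) (norm_nonneg _) (by positivity)).trans_eq (mul_one _)
    · exact (mul_le_mul (norm_taxiAcc_le_one L N hR' y j k) hlegterm (norm_nonneg _) zero_le_one).trans_eq (one_mul _)

/-- **FED⁺'s ONE-BLOCK SITE MISMATCH OF TAXI DATA** — the `m₀` of V-FED (`VariationalVectorFederbushLine.curlSq_QvL_line_le`,
`VariationalVectorFederbushLinePhys.ScV_QvL_line_le_curl`) and the `m` of FED⁺-colour (`VariationalColourFederbush.dirUv_Qcv_le`) at taxi data,
from the operator plaquette defect alone: `‖misv L N (coarseTv R′) R′ (taxiTv R′) y μ j‖ ≤ (d−1)·L·(L−1)·a`. [folklore] -/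
theorem norm_misv_taxi_le (y : Tor N) (μ : Fin d) (j : Fin d → Fin L) :
    ‖misv L N (coarseTv L N R') R' (taxiTv L N R') y μ j‖ ≤ ((d - 1 : ℕ) : ℝ) * L * ((L - 1 : ℕ) : ℝ) * a := by
  have h := coarse_mul_taxiAcc_sub_le L N hR' ha y j μ le_rfl
  rw [if_pos μ.is_lt, corner_d] at h
  unfold misv coarseTv
  rw [taxiTv_bpt, taxiTv_bpt]
  exact h.trans_eq (by ring)

end Mismatch

/-! ## §5 V-FED's curl half at taxi data: no mismatch binder left -/

section VFED

variable (n L : ℕ) [NeZero n] [NeZero L] (M : Fin d → ℕ) [hM : ∀ μ, NeZero (M μ)]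

/-- **LEAF V-FED, CURL HALF, AT TAXI DATA** (physical units; coarse level `n`, fine level `n·L`): contractive fine bond operators `R′` with operator
plaquette defect `≤ a`, coarse transports `coarseTv R′`, line transports `lineT (taxiTv R′) R′` (the straight run along the line, then the taxi to the
base point), any `G′ ≥ 0`: `ScV n M (coarseTv R′) 0 (Q_{taxiTv R′ ∘ Π} W′) ≤ ( √(SfV n L M R′ G′ W′) + d·n·(2((d−1)L(L−1)a + L²a) + 2L·(L²a))·√(qVV n L M W′) )²`
— `VariationalVectorFederbushLinePhys.ScV_QvL_line_le_curl` with `hT′`∕`hmis` DISCHARGED by §2∕§4. [folklore] -/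
theorem ScV_QvL_taxi_le_curl {R' : Tor (fine L (fine n M)) → Fin d → (E →L[ℂ] E)} (hR' : ∀ x μ, ‖R' x μ‖ ≤ 1) {a : ℝ} (ha0 : 0 ≤ a)
    (ha : ∀ x κ ι, ‖R' x κ * R' (x + unitVec (fine L (fine n M)) κ) ι - R' x ι * R' (x + unitVec (fine L (fine n M)) ι) κ‖ ≤ a)
    {G' : (Tor (fine L (fine n M)) → Fin d → E) → ℝ} (hG0' : ∀ W', 0 ≤ G' W') (W' : Tor (fine L (fine n M)) → Fin d → E) :
    ScV n M (coarseTv L (fine n M) R') (fun _ => 0) (QvL L (fine n M) (lineT L (fine n M) (taxiTv L (fine n M) R') R') W')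
      ≤ (Real.sqrt (SfV n L M R' G' W')
          + (d : ℝ) * ((n : ℝ) * (2 * (((d - 1 : ℕ) : ℝ) * L * ((L - 1 : ℕ) : ℝ) * a + L * L * a) + 2 * L * (L * L * a)))
            * Real.sqrt (qVV n L M W')) ^ 2 :=
  ScV_QvL_line_le_curl n L M hR' (norm_taxiTv_le_one L (fine n M) hR') (by positivity) ha0
    (fun y μ j => norm_misv_taxi_le L (fine n M) hR' ha y μ j) ha hG0' W'

end VFED

end Summit.QuantumFields.BalabanUV.T4Continuum.VariationalColourTaxiTransport

end
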